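import Summits.Ventures.HodgeRepro2.T5InertPlaceInertiaTrivial

/-!
# T5RamifiedPlaceInertiaFull — at a ramified place of a quadratic extension the inertia group is
the whole local Galois group: every `σ` acts trivially on the residue field

Tier-5 kernel support (N3, the non-split places) — p8, gen 15.  §8(d): uses an L-value-free
non-vanishing device: NO.

The companion of `T5InertPlaceInertiaTrivial` at a RAMIFIED place (`e(w/v) = 2`, local degree `2`):
Mathlib's `|inertia| = e` gives `|inertia| = 2 = |Gal(L_w / K_v)|`, so
* `card_inertia_eq_two` / `inertia_eq_top` — the inertia group is everything;
* `smul_sub_mem_maximalIdeal` / `residue_smul_eq` — every `σ ∈ Gal(L_w / K_v)` fixes every integer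
  modulo `𝔪_w`, i.e. acts trivially on the residue field (`𝓀_w = 𝓀_v`, the record's «`f = 1`»).
-/

namespace Summit.Ventures.HodgeRepro2.T5RamifiedPlaceInertiaFull

open IsDedekindDomain HeightOneSpectrum NumberField

variable {K : Type*} [Field K] [NumberField K] (v : HeightOneSpectrum (RingOfIntegers K))
variable {L : Type*} [Field L] [NumberField L] [Algebra K L]
  (w : HeightOneSpectrum (RingOfIntegers L)) [w.asIdeal.LiesOver v.asIdeal]

/-- At a ramified place of local degree `2` the inertia group of `𝔪_w` has two elements. -/
theorem card_inertia_eq_two (he : v.asIdeal.ramificationIdx' w.asIdeal = 2)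
    (h2 : Module.finrank (v.adicCompletion K) (w.adicCompletion L) = 2) :
    letI : MulSemiringAction (w.adicCompletion L ≃ₐ[v.adicCompletion K] w.adicCompletion L)
      (w.adicCompletionIntegers L) :=
      IsIntegralClosure.MulSemiringAction (v.adicCompletionIntegers K) (v.adicCompletion K)
        (w.adicCompletion L) (w.adicCompletionIntegers L)
    Nat.card (Ideal.inertia (w.adicCompletion L ≃ₐ[v.adicCompletion K] w.adicCompletion L)
      (IsLocalRing.maximalIdeal (w.adicCompletionIntegers L))) = 2 := by
  haveI := T5InertPlaceCompletion.isGalois_adicCompletion v w h2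
  letI : MulSemiringAction (w.adicCompletion L ≃ₐ[v.adicCompletion K] w.adicCompletion L)
    (w.adicCompletionIntegers L) :=
    IsIntegralClosure.MulSemiringAction (v.adicCompletionIntegers K) (v.adicCompletion K)
      (w.adicCompletion L) (w.adicCompletionIntegers L)
  haveI : IsGaloisGroup (w.adicCompletion L ≃ₐ[v.adicCompletion K] w.adicCompletion L)
      (v.adicCompletionIntegers K) (w.adicCompletionIntegers L) :=
    IsGaloisGroup.of_isFractionRing _ _ _ (v.adicCompletion K) (w.adicCompletion L)
  haveI : Finite ((v.adicCompletionIntegers K) ⧸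
      IsLocalRing.maximalIdeal (v.adicCompletionIntegers K)) :=
    (inferInstance : Finite (IsLocalRing.ResidueField (v.adicCompletionIntegers K)))
  haveI : (IsLocalRing.maximalIdeal (w.adicCompletionIntegers L)).LiesOver
      (IsLocalRing.maximalIdeal (v.adicCompletionIntegers K)) := inferInstance
  rw [Ideal.card_inertia_eq_ramificationIdxIn (IsLocalRing.maximalIdeal (v.adicCompletionIntegers K))
      (IsLocalRing.maximalIdeal (w.adicCompletionIntegers L)),
    Ideal.ramificationIdxIn_eq_ramificationIdx _ (IsLocalRing.maximalIdeal (w.adicCompletionIntegers L))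
      (w.adicCompletion L ≃ₐ[v.adicCompletion K] w.adicCompletion L),
    ← Ideal.ramificationIdx'_eq_ramificationIdx _ _ (IsDiscreteValuationRing.not_a_field _),
    T5InertGlobalToLocal.ramificationIdx'_maximalIdeal_eq v w, he]

/-- At a ramified place the inertia group is the whole local Galois group. -/
theorem inertia_eq_top (he : v.asIdeal.ramificationIdx' w.asIdeal = 2)
    (h2 : Module.finrank (v.adicCompletion K) (w.adicCompletion L) = 2) :
    letI : MulSemiringAction (w.adicCompletion L ≃ₐ[v.adicCompletion K] w.adicCompletion L)
      (w.adicCompletionIntegers L) :=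
      IsIntegralClosure.MulSemiringAction (v.adicCompletionIntegers K) (v.adicCompletion K)
        (w.adicCompletion L) (w.adicCompletionIntegers L)
    Ideal.inertia (w.adicCompletion L ≃ₐ[v.adicCompletion K] w.adicCompletion L)
      (IsLocalRing.maximalIdeal (w.adicCompletionIntegers L)) = ⊤ := by
  letI : MulSemiringAction (w.adicCompletion L ≃ₐ[v.adicCompletion K] w.adicCompletion L)
    (w.adicCompletionIntegers L) :=
    IsIntegralClosure.MulSemiringAction (v.adicCompletionIntegers K) (v.adicCompletion K)
      (w.adicCompletion L) (w.adicCompletionIntegers L)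
  haveI := T5InertPlaceCompletion.isGalois_adicCompletion v w h2
  apply Subgroup.eq_top_of_card_eq
  rw [card_inertia_eq_two v w he h2, IsGalois.card_aut_eq_finrank, h2]

/-- At a ramified place every `σ ∈ Gal(L_w / K_v)` fixes every integer modulo `𝔪_w`. -/
theorem smul_sub_mem_maximalIdeal (he : v.asIdeal.ramificationIdx' w.asIdeal = 2)
    (h2 : Module.finrank (v.adicCompletion K) (w.adicCompletion L) = 2)
    (σ : w.adicCompletion L ≃ₐ[v.adicCompletion K] w.adicCompletion L)
    (x : w.adicCompletionIntegers L) :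
    letI : MulSemiringAction (w.adicCompletion L ≃ₐ[v.adicCompletion K] w.adicCompletion L)
      (w.adicCompletionIntegers L) :=
      IsIntegralClosure.MulSemiringAction (v.adicCompletionIntegers K) (v.adicCompletion K)
        (w.adicCompletion L) (w.adicCompletionIntegers L)
    σ • x - x ∈ IsLocalRing.maximalIdeal (w.adicCompletionIntegers L) := by
  letI : MulSemiringAction (w.adicCompletion L ≃ₐ[v.adicCompletion K] w.adicCompletion L)
    (w.adicCompletionIntegers L) :=
    IsIntegralClosure.MulSemiringAction (v.adicCompletionIntegers K) (v.adicCompletion K)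
      (w.adicCompletion L) (w.adicCompletionIntegers L)
  have hmem : σ ∈ Ideal.inertia (w.adicCompletion L ≃ₐ[v.adicCompletion K] w.adicCompletion L)
      (IsLocalRing.maximalIdeal (w.adicCompletionIntegers L)) := by
    rw [inertia_eq_top v w he h2]
    exact Subgroup.mem_top σ
  exact hmem x

/-- At a ramified place the local Galois group acts trivially on the residue field. -/
theorem residue_smul_eq (he : v.asIdeal.ramificationIdx' w.asIdeal = 2)
    (h2 : Module.finrank (v.adicCompletion K) (w.adicCompletion L) = 2)
    (σ : w.adicCompletion L ≃ₐ[v.adicCompletion K] w.adicCompletion L)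
    (x : w.adicCompletionIntegers L) :
    letI : MulSemiringAction (w.adicCompletion L ≃ₐ[v.adicCompletion K] w.adicCompletion L)
      (w.adicCompletionIntegers L) :=
      IsIntegralClosure.MulSemiringAction (v.adicCompletionIntegers K) (v.adicCompletion K)
        (w.adicCompletion L) (w.adicCompletionIntegers L)
    IsLocalRing.residue (w.adicCompletionIntegers L) (σ • x) =
      IsLocalRing.residue (w.adicCompletionIntegers L) x :=
  Ideal.Quotient.eq.2 (smul_sub_mem_maximalIdeal v w he h2 σ x)

end Summit.Ventures.HodgeRepro2.T5RamifiedPlaceInertiaFull
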